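import Literature.Analysis.FluidPDE.OseenDuhamelMeasurable
import Literature.Analysis.FluidPDE.OseenHeatDuality
import Literature.Analysis.FluidPDE.ForwardMildWeak
import HarnessLib

/-!
# The Oseen–Duhamel integral of `u ⊗ u` is a weak solution of the linear Stokes system

Analysis/FluidPDE support file (everything proved; no named facts) on the discharge path of
`Literature.Analysis.FluidPDE.KNSS2009_weak_driftMild` (`KNSSRegularityDecomposition.lean`:
Koch–Nadirashvili–Seregin–Šverák 2009, Lemma 3.1 in drift-mild form). KNSS prove Lemma 3.1 for
a weak solution `u` of the linear Stokes system (3.1) with right-hand side `∂ₖfₖ` by subtracting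
the **mild solution** `v` of (3.1)–(3.2) with `u₀ = 0` ((3.3)) and treating the homogeneous case:
"In view of estimates (3.10) it is enough to consider only the case `f = 0`" (proof of
Lemma 3.1, arXiv p. 7) — which uses tacitly that the mild solution `v` is itself a weak solution.
This file proves that step for the Navier–Stokes forcing `fₖ = −uₖu` of §4, in the tree's
realisation: for a jointly measurable field `u` bounded by `M` on `ℝ × E` (`dim E = 3`), the
Duhamel velocity `∫₀ᵗ 𝒩_{t−σ}(u ⊗ u)(σ) dσ = driftDuhamel u 0 0 t` (`𝒩_τ = e^{τΔ}P∇· = oseenHeat τ`;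
KNSS's `v` is its negative) satisfies

* `integral_inner_driftDuhamel_zero_heatAdjoint_eq` — **the weak Stokes identity**: for every
  space–time test field `ψ` on `(0, T) × E` with divergence-free slices,
  `∫₀ᵀ ∫ ⟪∫₀ᵗ 𝒩_{t−σ}(u ⊗ u) dσ, ∂ₜψ + Δψ⟫ dx dt = ∫₀ᵀ ∫ ⟪u, (u·∇)ψ⟫ dx dt`, i.e.
  `∫∫ v·(∂ₜψ + Δψ) = ∫∫ fₖ ∂ₖψ` with `fₖ = −uₖu` (KNSS §3 p. 7, the definition of weak solutions);
* `IsBoundedWeakNSSolutionOn.integral_inner_add_driftDuhamel_heatAdjoint_eq_zero` — hence for a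
  bounded weak Navier–Stokes solution `u` on `(0, T)` (`IsBoundedWeakNSSolutionOn`, `ν = 1`) the
  field `z = u − v = u + ∫₀ᵗ 𝒩_{t−σ}(u ⊗ u) dσ` is a bounded weak solution of the **homogeneous**
  Stokes system, `∫∫ ⟪z, ∂ₜψ + Δψ⟫ = 0`, with weakly divergence-free slices for a.e. `t`
  (`IsBoundedWeakNSSolutionOn.ae_isWeaklyDivFree_add_driftDuhamel`; the Duhamel velocity is weakly
  divergence free for every `t`, `isWeaklyDivFree_driftDuhamel_zero`, by `div 𝒩 = 0`).

## Proof

With `Λ = ∂ₜψ + Δψ` (a space–time test field on `ℝ × E` with divergence-free slices,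
`IsSpaceTimeTestOn.heatAdjointField_top`) each slice pairing is rewritten as a transport integral,
`⟨∫₀ᵗ 𝒩_{t−σ}(u ⊗ u) dσ, Λ(t)⟩ = −∫_{(0,b]×E} ⟪u, K_t u⟫` with the kernel
`K_t(σ, y) = 1_{σ<t} D(e^{(t−σ)Δ}Λ(t))(y)` (`integral_inner_driftDuhamel_zero_eq_slab`): the inner
product commutes with the `σ`-integral, Fubini in `(x, σ)` (majorant `8829(t−σ)^{-1/2}·4M²·‖Λ‖`),
the pairing identity `⟨𝒩_τF, Φ⟩ = −⟨F, ∇e^{τΔ}Φ⟩` for divergence-free `Φ`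
(`sum_integral_oseenHeat_mul_inner_eq`, `OseenHeatWeakDiv.lean`) and the frame expansion
`∑ᵢⱼ uⱼuᵢ ∂ⱼGᵢ = ⟪u, DG u⟫` (`sum_sum_integral_tensor_mul_heatD1_eq`, via `heatD1_inner_const_eq` and `sum_sum_inner_mul_inner_mul_inner_apply` of `OseenHeatDuality.lean`). Then the tree's slab duality
(`setIntegral_slab_duality_of_norm_le`, `AncientMildWeak.lean`) integrates in `t` and evaluates
`∫ K_t dt = D𝒰[Λ]` (`setIntegral_transportKernel_eq_fderiv_heatDuhamelBack`, `KatoUniquenessDual`),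
and the backward heat equation of the backward caloric Duhamel integral gives `𝒰[Λ] = −ψ`
(`heatDuhamelBack_heatAdjointField`), whence `∫∫ ⟪v, Λ⟫ = −∫∫⟪u, (u·∇)ψ⟫` for `v = −∫₀ᵗ 𝒩 dσ`.
This is the proof of "mild ⇒ weak" of `AncientMildWeak.lean` run on the explicit Duhamel
integral instead of the duality-form mild class.

## Mathlib / tree search

Tree: `driftTensor`, `driftDuhamel` (`KNSSRegularityDecomposition`); the measurable-forcing
Duhamel calculus (`OseenDuhamelMeasurable`: `intervalIntegrable_sum_oseenHeat_sub_smul`,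
`norm_sum_oseenHeat_duhamelIntegrand_smul_le`, `aestronglyMeasurable_oseenHeat_clock_prod`,
`continuousOn_integral_sum_oseenHeat_duhamel_prod`, `memLp_top_slice_of_bound`); the pairing
identities (`OseenHeatWeakDiv`; the `Lᵖ` versions and the frame/coordinate helpers
`heatD1_inner_const_eq`, `sum_sum_inner_mul_inner_mul_inner_apply` are in `OseenHeatDuality`, whose
`integral_inner_sum_oseenHeat_tensor_eq_neg` is the single-slice form of the conversion used here);
space–time test fields, the adjoint field, transport kernel and slab duality (`AncientMildWeak`,
`ForwardMildWeak` (`IsSpaceTimeTestOn.exists_time_support_Ioo`), `KatoUniquenessDual`,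
`HeatDuhamelBack`); `heatD1`, `memLp_heatD1`. No prior statement that a
Duhamel/Oseen integral is a weak Stokes solution for bounded data (`lean search 'driftDuhamel|
oseenDuhamel.*timeDeriv|IsBoundedWeakNSSolutionOn.*oseen'`: nothing; `ForwardMildWeak`/
`AncientMildWeak` treat the duality-form mild class). Mathlib: `integral_inner`,
`integral_integral_swap`, `Integrable.mul_prod`, `OrthonormalBasis.sum_repr'`,
`OrthonormalBasis.sum_inner_mul_inner`, `fderiv_comp`, `setIntegral_eq_of_subset_of_forall_sdiff_eq_zero`.

## References

* G. Koch, N. Nadirashvili, G. Seregin, V. Šverák, *Liouville theorems for the Navier–Stokes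
  equations and applications*, Acta Math. 203 (2009) = arXiv:0709.3599v1, §3 (3.3)–(3.5), the
  definition of weak solutions and the proof of Lemma 3.1 (p. 7); §4 (ii) and the closing
  paragraph (p. 8). [KochNadirashviliSereginSverak2009]
* P. G. Lemarié-Rieusset, *The Navier–Stokes problem in the 21st century*, CRC Press 2016,
  Prop. 4.3 (backward Duhamel integral) and proof of Thm. 7.7, fourth step. [LemarieRieusset2016]
-/

open MeasureTheory Filter Topology Set InnerProductSpace Metric Function TopologicalSpace
open scoped Real ENNReal NNReal Convolution Laplacian RealInnerProductSpace ContDiff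

noncomputable section

namespace Literature.Analysis.FluidPDE

/-! ## From frame components to the transport pairing `⟪w, D(e^{τΔ}Φ) w⟫` -/

section Conversion

variable {E : Type*} [NormedAddCommGroup E] [InnerProductSpace ℝ E] [FiniteDimensional ℝ E]
  [MeasurableSpace E] [BorelSpace E]

/-- **From frame components to the transport pairing.** For a bounded measurable field `w`, a
compactly supported `C¹` field `Φ` and `τ > 0`:
`∑ᵢⱼ ∫ ⟪w, eⱼ⟫⟪w, eᵢ⟫ ∂ⱼ e^{τΔ}Φᵢ = ∫ ⟪w, D(e^{τΔ}Φ) w⟫`, i.e. `⟨w ⊗ w, ∇e^{τΔ}Φ⟩ = ⟨w, (w·∇)e^{τΔ}Φ⟩`.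
[folklore] -/
theorem sum_sum_integral_tensor_mul_heatD1_eq {w : E → E} (hw : AEStronglyMeasurable w volume)
    {M : ℝ} (hM : ∀ y, ‖w y‖ ≤ M) {Φ : E → E} (hΦ : ContDiff ℝ 1 Φ) (hΦc : HasCompactSupport Φ)
    {τ : ℝ} (hτ : 0 < τ) :
    ∑ i, ∑ j, ∫ y, (⟪w y, stdOrthonormalBasis ℝ E j⟫ * ⟪w y, stdOrthonormalBasis ℝ E i⟫) *
        heatD1 τ (stdOrthonormalBasis ℝ E j) (fun x => ⟪Φ x, stdOrthonormalBasis ℝ E i⟫) y =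
      ∫ y, ⟪w y, fderiv ℝ (UnboundedOperators.heatExtension Φ τ) y (w y)⟫ := by
  set e := stdOrthonormalBasis ℝ E
  set G := UnboundedOperators.heatExtension Φ τ with hG
  have hcomp : ∀ i j y, (⟪w y, e j⟫ * ⟪w y, e i⟫) * heatD1 τ (e j) (fun x => ⟪Φ x, e i⟫) y =
      (⟪w y, e j⟫ * ⟪w y, e i⟫) * ⟪fderiv ℝ G y (e j), e i⟫ := fun i j y => by
    rw [heatD1_inner_const_eq Φ hΦ hΦc i j y]
  simp_rw [hcomp]
  -- integrability of each term: bounded `w`, integrable `DG`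
  have hΦi : ∀ i, MemLp (fun x => ⟪Φ x, e i⟫) 1 volume := fun i =>
    memLp_one_iff_integrable.2 ((hΦ.continuous.inner continuous_const).integrable_of_hasCompactSupport
      (hΦc.mono (fun x hx => by
        contrapose! hx
        simp [Function.notMem_support.1 hx])))
  have hDi : ∀ i j, Integrable (fun y => ⟪fderiv ℝ G y (e j), e i⟫) volume := by
    intro i j
    have h := memLp_one_iff_integrable.1 (memLp_heatD1 (hΦi i) le_rfl hτ (e j))
    refine h.congr (Eventually.of_forall fun y => ?_)
    exact heatD1_inner_const_eq Φ hΦ hΦc i j y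
  have hwi : ∀ i, AEStronglyMeasurable (fun y => ⟪w y, e i⟫) volume := fun i => hw.inner aestronglyMeasurable_const
  have hwb : ∀ i y, ‖⟪w y, e i⟫‖ ≤ M := fun i y => by
    rw [Real.norm_eq_abs]
    exact (abs_inner_stdOrthonormalBasis_le (w y) i).trans (hM y)
  have hint : ∀ i j, Integrable (fun y => (⟪w y, e j⟫ * ⟪w y, e i⟫) * ⟪fderiv ℝ G y (e j), e i⟫) volume := by
    intro i j
    have h1 : Integrable (fun y => ⟪w y, e i⟫ * ⟪fderiv ℝ G y (e j), e i⟫) volume :=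
      (hDi i j).bdd_mul (hwi i) (Eventually.of_forall (hwb i))
    have h2 := h1.bdd_mul (hwi j) (Eventually.of_forall (hwb j))
    exact h2.congr (Eventually.of_forall fun y => by ring)
  have hrhs : (fun y => ⟪w y, fderiv ℝ G y (w y)⟫) =
      fun y => ∑ i, ∑ j, (⟪w y, e j⟫ * ⟪w y, e i⟫) * ⟪fderiv ℝ G y (e j), e i⟫ :=
    funext fun y => (sum_sum_inner_mul_inner_mul_inner_apply (fderiv ℝ G y) (w y) (w y)).symm
  rw [hrhs, integral_finsetSum _ (fun i _ => integrable_finsetSum _ fun j _ => hint i j)]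
  refine Finset.sum_congr rfl fun i _ => ?_
  rw [integral_finsetSum _ fun j _ => hint i j]

end Conversion

/-! ## The slice pairing `⟨∫₀ᵗ 𝒩_{t−σ}(u ⊗ u) dσ, Θ(t)⟩` as a transport integral -/

section Slice

variable {E : Type*} [NormedAddCommGroup E] [InnerProductSpace ℝ E] [FiniteDimensional ℝ E]
  [MeasurableSpace E] [BorelSpace E]

variable (hE : Module.finrank ℝ E = 3)
include hE

variable {u : ℝ → E → E} {M : ℝ}

omit [MeasurableSpace E] [BorelSpace E] hE in
/-- The tensor `u ⊗ u` of a field bounded by `M` (as `driftTensor u 0`) is bounded by `4M²`.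
[folklore] -/
theorem abs_driftTensor_zero_le (hM : ∀ t x, ‖u t x‖ ≤ M) (σ : ℝ)
    (j k : Fin (Module.finrank ℝ E)) (y : E) :
    |driftTensor u (fun _ => (0 : E)) σ j k y| ≤ 4 * M ^ 2 := by
  have hM0 : 0 ≤ M := (norm_nonneg _).trans (hM 0 y)
  exact abs_driftTensor_le (hM σ y) (by simpa using hM0) j k

/-- **The pairing of the Duhamel velocity with a field as an iterated integral**: for a jointly
measurable `u` bounded by `M`, `t > 0` and a continuous integrable field `Φ`,
`⟨∫₀ᵗ 𝒩_{t−σ}(u ⊗ u)(σ) dσ, Φ⟩ = ∫_{σ∈(0,t)} ⟨𝒩_{t−σ}(u ⊗ u)(σ), Φ⟩ dσ` (the inner product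
commutes with the Bochner integral; Fubini in `(x, σ)` with the majorant
`8829 (t−σ)^{-1/2} · 4M² · ‖Φ(x)‖`). [folklore] -/
theorem integral_inner_driftDuhamel_zero_eq_setIntegral (hum : Measurable (uncurry u))
    (hM : ∀ t x, ‖u t x‖ ≤ M) {t : ℝ} (ht : 0 < t) {Φ : E → E} (hΦ : Continuous Φ)
    (hΦi : Integrable Φ) :
    ∫ x, ⟪driftDuhamel u (fun _ => (0 : E)) 0 t x, Φ x⟫ =
      ∫ σ in Ioo 0 t, ∫ x, ⟪∑ i, oseenHeat (t - σ) (driftTensor u (fun _ => (0 : E)) σ) i x •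
        stdOrthonormalBasis ℝ E i, Φ x⟫ := by
  set e := stdOrthonormalBasis ℝ E
  set F : ℝ → Fin (Module.finrank ℝ E) → Fin (Module.finrank ℝ E) → E → ℝ :=
    driftTensor u (fun _ => (0 : E)) with hF
  have hM0 : 0 ≤ M := (norm_nonneg _).trans (hM 0 0)
  have hmeas : ∀ j k, Measurable fun q : ℝ × E => F q.1 j k q.2 :=
    measurable_driftTensor hum measurable_const
  have hB : ∀ σ j k y, |F σ j k y| ≤ 4 * M ^ 2 := fun σ => abs_driftTensor_zero_le hM σ
  have hB0 : (0 : ℝ) ≤ 4 * M ^ 2 := by positivity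
  -- Step 1: the pairing inside the `σ`-integral
  have hvecint : ∀ x, IntervalIntegrable (fun σ => ∑ i, oseenHeat (t - σ) (F σ) i x • e i) volume 0 t :=
    fun x => intervalIntegrable_sum_oseenHeat_sub_smul hE hmeas hB0 ht.le (fun σ _ => hB σ) x
  have h1 : ∀ x, ⟪driftDuhamel u (fun _ => (0 : E)) 0 t x, Φ x⟫ =
      ∫ σ in Ioc 0 t, ⟪∑ i, oseenHeat (t - σ) (F σ) i x • e i, Φ x⟫ := fun x => by
    rw [driftDuhamel_apply, intervalIntegral.integral_of_le ht.le, real_inner_comm,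
      ← integral_inner ((intervalIntegrable_iff_integrableOn_Ioc_of_le ht.le).1 (hvecint x)) (Φ x)]
    exact integral_congr_ae (Eventually.of_forall fun σ => real_inner_comm _ _)
  simp_rw [h1]
  -- Step 2: Fubini in `(x, σ)`
  set μσ : Measure ℝ := volume.restrict (Ioc 0 t) with hμσ
  have hμσ' : μσ = volume.restrict (Ioo 0 t) := by
    rw [hμσ, Measure.restrict_congr_set Ioo_ae_eq_Ioc]
  have hvecm : AEStronglyMeasurable (fun q : ℝ × E => ∑ i, oseenHeat (t - q.1) (F q.1) i q.2 • e i)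
      (μσ.prod (volume : Measure E)) := by
    rw [hμσ']
    exact Finset.aestronglyMeasurable_fun_sum _ fun i _ =>
      (aestronglyMeasurable_oseenHeat_clock_prod hmeas measurableSet_Ioo (fun σ _ => hB σ)
        (measurable_const.sub measurable_id) (fun σ hσ => sub_pos.2 hσ.2) i).smul_const _
  have hGm : AEStronglyMeasurable (fun q : ℝ × E => ⟪∑ i, oseenHeat (t - q.1) (F q.1) i q.2 • e i, Φ q.2⟫)
      (μσ.prod (volume : Measure E)) :=
    hvecm.inner (hΦ.comp_aestronglyMeasurable measurable_snd.aestronglyMeasurable)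
  have hGi : Integrable (fun q : ℝ × E => ⟪∑ i, oseenHeat (t - q.1) (F q.1) i q.2 • e i, Φ q.2⟫)
      (μσ.prod (volume : Measure E)) := by
    have hmaj : Integrable (fun q : ℝ × E => (8829 * (t - q.1) ^ (-(1 / 2 : ℝ)) * (4 * M ^ 2)) * ‖Φ q.2‖)
        (μσ.prod (volume : Measure E)) := by
      have h1 : Integrable (fun σ : ℝ => 8829 * (t - σ) ^ (-(1 / 2 : ℝ)) * (4 * M ^ 2)) μσ := by
        rw [hμσ]
        exact (intervalIntegrable_iff_integrableOn_Ioc_of_le ht.le).1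
          (((intervalIntegrable_rpow_neg_half_sub 0 t t).const_mul 8829).mul_const _)
      exact h1.mul_prod hΦi.norm
    refine hmaj.mono' hGm ?_
    have hae : ∀ᵐ q ∂(μσ.prod (volume : Measure E)), q.1 ∈ Ioo 0 t := by
      refine (Measure.quasiMeasurePreserving_fst (μ := μσ) (ν := (volume : Measure E))).ae ?_
      rw [hμσ']
      exact ae_restrict_mem measurableSet_Ioo
    filter_upwards [hae] with q hq
    calc ‖⟪∑ i, oseenHeat (t - q.1) (F q.1) i q.2 • e i, Φ q.2⟫‖
        ≤ ‖∑ i, oseenHeat (t - q.1) (F q.1) i q.2 • e i‖ * ‖Φ q.2‖ := norm_inner_le_norm _ _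
      _ ≤ (8829 * (t - q.1) ^ (-(1 / 2 : ℝ)) * (4 * M ^ 2)) * ‖Φ q.2‖ :=
          mul_le_mul_of_nonneg_right
            (norm_sum_oseenHeat_duhamelIntegrand_smul_le hE hmeas hB0 hq.2 (hB q.1) q.2) (norm_nonneg _)
  have hswap := integral_integral_swap (μ := (volume : Measure E)) (ν := μσ)
    (f := fun x σ => ⟪∑ i, oseenHeat (t - σ) (F σ) i x • e i, Φ x⟫) hGi.swap
  rw [hswap, hμσ']

/-- **The Duhamel velocity is weakly divergence free**: for every `t > 0`,
`x ↦ ∫₀ᵗ 𝒩_{t−σ}(u ⊗ u)(σ)(x) dσ` is weakly divergence free (slice by slice, `div 𝒩 = 0`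
weakly, `isWeaklyDivFree_sum_oseenHeat_smul`). [folklore] -/
theorem isWeaklyDivFree_driftDuhamel_zero (hum : Measurable (uncurry u)) (hM : ∀ t x, ‖u t x‖ ≤ M)
    {t : ℝ} (ht : 0 < t) :
    IsWeaklyDivFree (driftDuhamel u (fun _ => (0 : E)) 0 t) := by
  intro θ hθ
  have hg : Continuous (gradient θ) := continuous_gradient_of_contDiff (hθ.contDiff.of_le (by simp))
  have hgc : HasCompactSupport (gradient θ) :=
    hθ.hasCompactSupport.mono' fun x hx => by
      by_contra h
      exact hx (gradient_eq_zero_of_notMem_tsupport h)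
  rw [integral_inner_driftDuhamel_zero_eq_setIntegral hE hum hM ht hg (hg.integrable_of_hasCompactSupport hgc)]
  refine (setIntegral_congr_fun measurableSet_Ioo fun σ hσ => ?_).trans (integral_zero _ _)
  have hmeas : ∀ j k, Measurable fun q : ℝ × E => driftTensor u (fun _ => (0 : E)) q.1 j k q.2 :=
    measurable_driftTensor hum measurable_const
  have hFσ : ∀ j k, MemLp (driftTensor u (fun _ => (0 : E)) σ j k) ∞ volume := fun j k =>
    (memLp_top_slice_of_bound hmeas (abs_driftTensor_zero_le hM σ) j k).1
  exact isWeaklyDivFree_sum_oseenHeat_smul hE hFσ (sub_pos.2 hσ.2) θ hθ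

/-- **The slice pairing as an iterated transport integral.** For a jointly measurable field `u`
bounded by `M`, `t > 0`, and a compactly supported `C¹` divergence-free field `Φ`:
`⟨∫₀ᵗ 𝒩_{t−σ}(u ⊗ u)(σ) dσ, Φ⟩ = −∫_{σ∈(0,t)} ∫ ⟪u(σ), D(e^{(t−σ)Δ}Φ)(u(σ))⟫ dy dσ`
(the iterated form, the pairing identity `sum_integral_oseenHeat_mul_inner_eq` slice by slice,
and the frame-to-pairing conversion). [folklore] -/
theorem integral_inner_driftDuhamel_zero_eq (hum : Measurable (uncurry u)) (hM : ∀ t x, ‖u t x‖ ≤ M)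
    {t : ℝ} (ht : 0 < t) {Φ : E → E} (hΦ : ContDiff ℝ 1 Φ) (hΦc : HasCompactSupport Φ)
    (hdiv : VectorCalculus.IsDivFree Φ) :
    ∫ x, ⟪driftDuhamel u (fun _ => (0 : E)) 0 t x, Φ x⟫ =
      -∫ σ in Ioo 0 t, ∫ y, ⟪u σ y,
        fderiv ℝ (UnboundedOperators.heatExtension Φ (t - σ)) y (u σ y)⟫ := by
  set e := stdOrthonormalBasis ℝ E
  set F : ℝ → Fin (Module.finrank ℝ E) → Fin (Module.finrank ℝ E) → E → ℝ :=
    driftTensor u (fun _ => (0 : E)) with hF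
  have hmeas : ∀ j k, Measurable fun q : ℝ × E => F q.1 j k q.2 :=
    measurable_driftTensor hum measurable_const
  have hB : ∀ σ j k y, |F σ j k y| ≤ 4 * M ^ 2 := fun σ => abs_driftTensor_zero_le hM σ
  have hΦcont : Continuous Φ := hΦ.continuous
  have hΦint : Integrable Φ := hΦcont.integrable_of_hasCompactSupport hΦc
  rw [integral_inner_driftDuhamel_zero_eq_setIntegral hE hum hM ht hΦcont hΦint, ← integral_neg]
  refine setIntegral_congr_fun measurableSet_Ioo fun σ hσ => ?_
  have hτ : 0 < t - σ := sub_pos.2 hσ.2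
  have hFσ : ∀ j k, MemLp (F σ j k) ∞ volume := fun j k =>
    (memLp_top_slice_of_bound hmeas (hB σ) j k).1
  -- `⟪∑ᵢ aᵢ eᵢ, Φ⟫ = ∑ᵢ aᵢ ⟪Φ, eᵢ⟫`
  have hsum : ∀ x, ⟪∑ i, oseenHeat (t - σ) (F σ) i x • e i, Φ x⟫ =
      ∑ i, oseenHeat (t - σ) (F σ) i x * ⟪Φ x, e i⟫ := fun x => by
    rw [sum_inner]
    exact Finset.sum_congr rfl fun i _ => by rw [real_inner_smul_left, real_inner_comm]
  rw [show (fun x => ⟪∑ i, oseenHeat (t - σ) (driftTensor u (fun _ => (0 : E)) σ) i x •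
      stdOrthonormalBasis ℝ E i, Φ x⟫) = fun x => ∑ i, oseenHeat (t - σ) (F σ) i x * ⟪Φ x, e i⟫
    from funext hsum]
  have hinti : ∀ i, Integrable (fun x => oseenHeat (t - σ) (F σ) i x * ⟪Φ x, e i⟫) volume := by
    intro i
    obtain ⟨B', hB'0, hB'⟩ := exists_componentwise_bound hFσ
    have hci : Integrable (fun x => ⟪Φ x, e i⟫) volume := hΦint.inner_const (e i)
    exact hci.bdd_mul (aestronglyMeasurable_oseenHeat hE hFσ hτ i)
      (Eventually.of_forall fun x => norm_oseenHeat_le_of_top hE hFσ hB'0 hB' hτ i x)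
  rw [integral_finsetSum _ fun i _ => hinti i,
    sum_integral_oseenHeat_mul_inner_eq hE hFσ hτ hΦ hΦc hdiv]
  -- conversion to the transport pairing
  have hslm : AEStronglyMeasurable (u σ) volume :=
    (hum.comp (measurable_const.prodMk measurable_id)).aestronglyMeasurable
  have hconv := sum_sum_integral_tensor_mul_heatD1_eq hslm (fun y => hM σ y) hΦ hΦc hτ
  rw [neg_inj]
  rw [← hconv]
  refine Finset.sum_congr rfl fun i _ => Finset.sum_congr rfl fun j _ => ?_
  refine integral_congr_ae (Eventually.of_forall fun y => ?_)
  simp [hF, driftTensor_apply]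

/-- **Slab form of the slice pairing.** With the transport kernel
`K_t(σ, y) = 1_{σ<t} D(e^{(t−σ)Δ}Θ(t))(y)` of a space–time test field `Θ` on `ℝ × E` with
divergence-free slices, for `0 < t ≤ b`:
`⟨∫₀ᵗ 𝒩_{t−σ}(u ⊗ u) dσ, Θ(t)⟩ = −∫_{(0,b] × E} ⟪u, K_t u⟫`. [folklore] -/
theorem integral_inner_driftDuhamel_zero_eq_slab (hum : Measurable (uncurry u))
    (hM : ∀ t x, ‖u t x‖ ≤ M) {Θ : ℝ → E → E} (hΘ : IsSpaceTimeTestOn (⊤ : Opens (ℝ × E)) Θ)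
    (hΘdiv : ∀ t, VectorCalculus.IsDivFree (Θ t)) {t b : ℝ} (ht : 0 < t) (htb : t ≤ b) :
    ∫ x, ⟪driftDuhamel u (fun _ => (0 : E)) 0 t x, Θ t x⟫ =
      -∫ q, ⟪u q.1 q.2, (if q.1 < t then fderiv ℝ (heatTest 1 (Θ t) (t - q.1)) q.2 else 0)
          (u q.1 q.2)⟫ ∂((volume.restrict (Ioc 0 b)).prod (volume : Measure E)) := by
  rw [integral_inner_driftDuhamel_zero_eq hE hum hM ht (contDiff_infty.1 (hΘ.contDiff_slice t) 1)
    (hΘ.hasCompactSupport_slice t) (hΘdiv t)]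
  congr 1
  -- integrability of the transport integrand on the slab
  obtain ⟨R, -, hK1⟩ := hΘ.exists_integral_norm_transportKernel_le one_pos
  have hmeas' : AEStronglyMeasurable (uncurry u) ((volume.restrict (Ioc 0 b)).prod (volume : Measure E)) :=
    hum.aestronglyMeasurable
  have haτ : ∀ τ ∈ Icc 0 b, AEStronglyMeasurable (u τ) volume := fun τ _ =>
    (hum.comp (measurable_const.prodMk measurable_id)).aestronglyMeasurable
  have haM : ∀ τ ∈ Icc 0 b, ∀ x, ‖u τ x‖ ≤ M := fun τ _ x => hM τ x
  obtain ⟨hint, -⟩ := integrable_transportIntegrand_slab_of_norm_le (a := u)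
    (K := fun (t' : ℝ) (y : ℝ × E) => if y.1 < t' then fderiv ℝ (heatTest 1 (Θ t') (t' - y.1)) y.2 else 0)
    (le_of_lt (lt_of_lt_of_le ht htb)) hK1 (t := t) (hΘ.aestronglyMeasurable_transportKernel_slice one_pos t _)
    hmeas' haτ haM
  rw [integral_prod _ hint]
  -- restrict the `σ`-integral to `(0, t)`
  symm
  refine (setIntegral_eq_of_subset_of_forall_sdiff_eq_zero measurableSet_Ioc
    (Ioo_subset_Ioc_self.trans (Ioc_subset_Ioc_right htb)) fun σ hσ => ?_).trans ?_
  · have hσt : ¬ σ < t := fun h => hσ.2 ⟨hσ.1.1, h⟩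
    simp [hσt]
  · refine setIntegral_congr_fun measurableSet_Ioo fun σ hσ => ?_
    refine integral_congr_ae (Eventually.of_forall fun y => ?_)
    simp only [if_pos hσ.2]
    rw [heatTest_of_pos one_pos (sub_pos.2 hσ.2), one_mul]

end Slice

/-! ## The weak Stokes identity for the Oseen–Duhamel velocity `v = −∫₀ᵗ 𝒩_{t−σ}(u ⊗ u) dσ` -/

section Weak

variable {E : Type*} [NormedAddCommGroup E] [InnerProductSpace ℝ E] [FiniteDimensional ℝ E]
  [MeasurableSpace E] [BorelSpace E]

variable (hE : Module.finrank ℝ E = 3)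
include hE

variable {u : ℝ → E → E} {M : ℝ}

/-- **The Oseen–Duhamel velocity is a weak solution of the linear Stokes system with force
`∇·(−u ⊗ u)`** (KNSS 2009, §3: "by definition, a mild solution of the Cauchy problem (3.1) and
(3.2) is a function `u` defined by the formula (3.3)"; mild solutions are weak solutions, the
standing assumption behind Lemma 3.1). For a jointly measurable field `u` bounded by `M` and the
velocity `v(t) = −∫₀ᵗ e^{(t−σ)Δ}P∇·(u ⊗ u)(σ) dσ` (`−driftDuhamel u 0 0 t`), for every space–time
test field `ψ` on `(0, T) × E` with divergence-free slices:
`∫₀ᵀ ∫ ⟪∫₀ᵗ 𝒩_{t−σ}(u ⊗ u) dσ, ∂ₜψ + Δψ⟫ dx dt = ∫₀ᵀ ∫ ⟪u, (u·∇)ψ⟫ dx dt`, i.e.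
`∫∫ v·(∂ₜψ + Δψ) = ∫∫ (−u_k u)·∂_kψ` (KNSS's weak Stokes identity, §3 p. 7, with `f_k = −u_k u`).
Proof: with `Λ = ∂ₜψ + Δψ` and the transport kernel `K_t(σ, y) = 1_{σ<t} D(e^{(t−σ)Δ}Λ(t))(y)`,
each slice pairing is `∫ ⟪u, K_t u⟫` over the slab (`integral_inner_driftDuhamel_zero_eq_slab`);
Fubini on the slab (`setIntegral_slab_duality_of_norm_le`) and `∫ K_t dt = D𝒰[Λ] = −Dψ` (backward
heat equation of the backward caloric Duhamel integral `𝒰`) give the right-hand side. [cite: KochNadirashviliSereginSverak2009, §3 (3.3) and the definition of weak solutions p. 7 (arXiv:0709.3599v1)] -/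
theorem integral_inner_driftDuhamel_zero_heatAdjoint_eq (hum : Measurable (uncurry u))
    (hM : ∀ t x, ‖u t x‖ ≤ M) {T : ℝ} (hT : 0 < T) {ψ : ℝ → E → E}
    (hψ : IsSpaceTimeTestOn (slab E (Ioo 0 T) isOpen_Ioo) ψ)
    (hdiv : ∀ t, VectorCalculus.IsDivFree (ψ t)) :
    ∫ t in Ioo 0 T, ∫ x, ⟪driftDuhamel u (fun _ => (0 : E)) 0 t x, timeDeriv ψ t x + Δ (ψ t) x⟫ =
      ∫ t in Ioo 0 T, ∫ x, ⟪u t x, convect (u t) (ψ t) x⟫ := by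
  -- time support `[a', b] ⊂ (0, T)`
  obtain ⟨a', b, ha'0, ha'b, hbT, hsupp⟩ := hψ.exists_time_support_Ioo hT
  have hψ' : IsSpaceTimeTestOn (⊤ : Opens (ℝ × E)) ψ := hψ.mono le_top
  have hb0 : 0 < b := lt_of_lt_of_le ha'0 ha'b
  -- the adjoint field `Λ = ∂ₜψ + Δψ` (`ν = 1`)
  set Λ : ℝ → E → E := fun t x => timeDeriv ψ t x + (1 : ℝ) • Δ (ψ t) x with hΛ_def
  have hΛ : IsSpaceTimeTestOn (⊤ : Opens (ℝ × E)) Λ := hψ'.heatAdjointField_top 1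
  have hΛd : ∀ t, VectorCalculus.IsDivFree (Λ t) := fun t => hψ'.isDivFree_heatAdjointField hdiv 1 t
  have hΛsupp : ∀ t, t ∉ Icc a' b → Λ t = 0 := fun t ht =>
    heatAdjointField_eq_zero_of_time_support hsupp 1 ht
  have hΛeq : ∀ t x, timeDeriv ψ t x + Δ (ψ t) x = Λ t x := fun t x => by
    simp [hΛ_def]
  simp_rw [hΛeq]
  -- measurability and bounds of `u` on the slab `(0, b] × E`
  have hmeas' : AEStronglyMeasurable (uncurry u) ((volume.restrict (Ioc 0 b)).prod (volume : Measure E)) :=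
    hum.aestronglyMeasurable
  have hslm : ∀ τ, AEStronglyMeasurable (u τ) volume := fun τ =>
    (hum.comp (measurable_const.prodMk measurable_id)).aestronglyMeasurable
  have haτ : ∀ τ ∈ Icc 0 b, AEStronglyMeasurable (u τ) volume := fun τ _ => hslm τ
  have haM : ∀ τ ∈ Icc 0 b, ∀ x, ‖u τ x‖ ≤ M := fun τ _ x => hM τ x
  -- (1) slab duality for `Λ`
  obtain ⟨R, -, hK1⟩ := hΛ.exists_integral_norm_transportKernel_le one_pos
  have h1 : ∫ t in Ioc 0 b, (-∫ x, ⟪driftDuhamel u (fun _ => (0 : E)) 0 t x, Λ t x⟫) =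
      ∫ τ in Ioc 0 b, ∫ x, ⟪u τ x, fderiv ℝ (heatDuhamelBack 1 Λ τ) x (u τ x)⟫ :=
    setIntegral_slab_duality_of_norm_le (a := u)
      (K := fun (t' : ℝ) (y : ℝ × E) => if y.1 < t' then fderiv ℝ (heatTest 1 (Λ t') (t' - y.1)) y.2 else 0)
      hb0.le hK1 (hΛ.aestronglyMeasurable_transportKernel one_pos _)
      (fun t => hΛ.aestronglyMeasurable_transportKernel_slice one_pos t _) hmeas' haτ haM
      (fun t ht => by
        rw [integral_inner_driftDuhamel_zero_eq_slab hE hum hM hΛ hΛd ht.1 ht.2, neg_neg])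
      (fun y hy => ⟨hΛ.integrableOn_transportKernel_time one_pos 0 b y.1 y.2,
        hΛ.setIntegral_transportKernel_eq_fderiv_heatDuhamelBack one_pos hΛsupp le_rfl
          (Ioc_subset_Icc_self hy) y.2⟩)
  -- (2) `D𝒰[Λ](τ) = -Dψ(τ)`
  have h2 : ∀ τ x, fderiv ℝ (heatDuhamelBack 1 Λ τ) x = -fderiv ℝ (ψ τ) x := fun τ x => by
    have h : heatDuhamelBack 1 Λ τ = -(ψ τ) :=
      funext fun y => hψ'.heatDuhamelBack_heatAdjointField one_pos τ y
    rw [h, fderiv_neg]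
  -- (3) reduce both sides to `(0, b]`
  have hvan₁ : ∀ t ∈ Ioo 0 T \ Ioc 0 b,
      (∫ x, ⟪driftDuhamel u (fun _ => (0 : E)) 0 t x, Λ t x⟫) = 0 := by
    intro t ht
    have ht' : t ∉ Icc a' b := fun h => ht.2 ⟨ht.1.1, h.2⟩
    simp [hΛsupp t ht']
  have hvan₂ : ∀ t ∈ Ioo 0 T \ Ioc 0 b, (∫ x, ⟪u t x, convect (u t) (ψ t) x⟫) = 0 := by
    intro t ht
    have ht' : t ∉ Icc a' b := fun h => ht.2 ⟨ht.1.1, h.2⟩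
    have hDt : ∀ x, fderiv ℝ (ψ t) x = 0 := fun x => by
      rw [hsupp t ht']
      exact fderiv_const_apply 0
    simp [convect, hDt]
  have hsub : Ioc 0 b ⊆ Ioo 0 T := fun t ht => ⟨ht.1, lt_of_le_of_lt ht.2 hbT⟩
  rw [setIntegral_eq_of_subset_of_forall_sdiff_eq_zero measurableSet_Ioo hsub hvan₁,
    setIntegral_eq_of_subset_of_forall_sdiff_eq_zero measurableSet_Ioo hsub hvan₂]
  -- (4) conclude
  have h1' : ∫ t in Ioc 0 b, ∫ x, ⟪driftDuhamel u (fun _ => (0 : E)) 0 t x, Λ t x⟫ =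
      -∫ τ in Ioc 0 b, ∫ x, ⟪u τ x, fderiv ℝ (heatDuhamelBack 1 Λ τ) x (u τ x)⟫ := by
    rw [← h1, integral_neg, neg_neg]
  rw [h1', ← integral_neg]
  refine setIntegral_congr_fun measurableSet_Ioc fun τ _ => ?_
  rw [← integral_neg]
  refine integral_congr_ae (Eventually.of_forall fun x => ?_)
  dsimp only
  rw [h2, convect_apply, neg_apply, inner_neg_right, neg_neg]

/-- Uniform bound of the Duhamel velocity on `[0, T]`:
`‖∫₀ᵗ 𝒩_{t−σ}(u ⊗ u) dσ (x)‖ ≤ 70632 M² T^{1/2}` for `t ∈ [0, T]` (`17658 · 4`). [folklore] -/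
theorem norm_driftDuhamel_zero_le (hum : Measurable (uncurry u)) (hM : ∀ t x, ‖u t x‖ ≤ M)
    {T t : ℝ} (ht : t ∈ Icc 0 T) (x : E) :
    ‖driftDuhamel u (fun _ => (0 : E)) 0 t x‖ ≤ 70632 * M ^ 2 * T ^ (1 / 2 : ℝ) := by
  have hM0 : 0 ≤ M := (norm_nonneg _).trans (hM 0 0)
  have hmeas : ∀ j k, Measurable fun q : ℝ × E => driftTensor u (fun _ => (0 : E)) q.1 j k q.2 :=
    measurable_driftTensor hum measurable_const
  have h := norm_integral_sum_oseenHeat_sub_smul_le hE hmeas (by positivity : (0:ℝ) ≤ 4 * M ^ 2)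
    ht.1 (fun σ _ => abs_driftTensor_zero_le hM σ) x
  rw [driftDuhamel_apply, sub_zero] at *
  refine h.trans ?_
  have hT : t ^ (1 / 2 : ℝ) ≤ T ^ (1 / 2 : ℝ) := Real.rpow_le_rpow ht.1 ht.2 (by norm_num)
  nlinarith [Real.rpow_nonneg ht.1 (1 / 2 : ℝ), sq_nonneg M]

/-- The Duhamel velocity is jointly a.e. strongly measurable on every slab `(0, b] × E`, `b ≤ T`
(it is jointly continuous on `[0, T] × E`). [folklore] -/
theorem aestronglyMeasurable_uncurry_driftDuhamel_zero (hum : Measurable (uncurry u))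
    (hM : ∀ t x, ‖u t x‖ ≤ M) {T b : ℝ} (hb : b ≤ T) :
    AEStronglyMeasurable (uncurry fun t x => driftDuhamel u (fun _ => (0 : E)) 0 t x)
      ((volume.restrict (Ioc 0 b)).prod (volume : Measure E)) := by
  have hM0 : 0 ≤ M := (norm_nonneg _).trans (hM 0 0)
  have hmeas : ∀ j k, Measurable fun q : ℝ × E => driftTensor u (fun _ => (0 : E)) q.1 j k q.2 :=
    measurable_driftTensor hum measurable_const
  have hc := continuousOn_integral_sum_oseenHeat_duhamel_prod hE hmeas
    (by positivity : (0:ℝ) ≤ 4 * M ^ 2) (s := 0) (T := T) (fun σ _ => abs_driftTensor_zero_le hM σ)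
  have hc' : ContinuousOn (uncurry fun t x => driftDuhamel u (fun _ => (0 : E)) 0 t x)
      (Icc 0 T ×ˢ univ) := by
    refine hc.congr fun q _ => ?_
    simp [uncurry, driftDuhamel_apply]
  have hmeasS : MeasurableSet (Icc (0:ℝ) T ×ˢ (univ : Set E)) := measurableSet_Icc.prod MeasurableSet.univ
  have h := hc'.aestronglyMeasurable (μ := (volume : Measure ℝ).prod (volume : Measure E)) hmeasS
  rw [← Measure.prod_restrict, Measure.restrict_univ] at h
  exact h.mono_measure (Measure.prod_mono (Measure.restrict_mono (Ioc_subset_Icc_self.trans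
    (Icc_subset_Icc_right hb)) le_rfl) le_rfl)

/-- **Bounded weak Navier–Stokes solutions minus their Duhamel velocity solve the homogeneous
weak Stokes system** (KNSS 2009, §4 closing paragraph with §3 Lemma 3.1: for `u` a bounded weak
solution and `v` the mild solution of (3.1)–(3.2) with `f_k = −u_k u`, `u₀ = 0`, the difference
`u − v` is a bounded weak solution of the linear Stokes system with `f = 0`, to which Lemma 3.1
with `f = 0` applies: "In view of estimates (3.10) it is enough to consider only the case
`f = 0`"). For a jointly measurable representative `u` bounded by `M` of a bounded weak solution
on `(0, T)` (`ν = 1`) and every divergence-free space–time test field `ψ` on the slab: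
`∫₀ᵀ ∫ ⟪u + ∫₀ᵗ 𝒩_{t−σ}(u ⊗ u) dσ, ∂ₜψ + Δψ⟫ dx dt = 0` (`v = −∫₀ᵗ 𝒩_{t−σ}(u ⊗ u) dσ`). [cite: KochNadirashviliSereginSverak2009, §3 Lemma 3.1 (first sentence of the proof) and §4 p. 8 (arXiv:0709.3599v1)] -/
theorem IsBoundedWeakNSSolutionOn.integral_inner_add_driftDuhamel_heatAdjoint_eq_zero {T : ℝ}
    (hu : IsBoundedWeakNSSolutionOn (Ioo 0 T) isOpen_Ioo 1 u) (hum : Measurable (uncurry u))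
    (hM : ∀ t x, ‖u t x‖ ≤ M) (hT : 0 < T) {ψ : ℝ → E → E}
    (hψ : IsSpaceTimeTestOn (slab E (Ioo 0 T) isOpen_Ioo) ψ)
    (hdiv : ∀ t, VectorCalculus.IsDivFree (ψ t)) :
    ∫ t in Ioo 0 T, ∫ x, ⟪u t x + driftDuhamel u (fun _ => (0 : E)) 0 t x,
      timeDeriv ψ t x + Δ (ψ t) x⟫ = 0 := by
  have hψ' : IsSpaceTimeTestOn (⊤ : Opens (ℝ × E)) ψ := hψ.mono le_top
  set Λ : ℝ → E → E := fun t x => timeDeriv ψ t x + (1 : ℝ) • Δ (ψ t) x with hΛ_def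
  have hΛ : IsSpaceTimeTestOn (⊤ : Opens (ℝ × E)) Λ := hψ'.heatAdjointField_top 1
  have hΛeq : ∀ t x, timeDeriv ψ t x + Δ (ψ t) x = Λ t x := fun t x => by simp [hΛ_def]
  set D : ℝ → E → E := fun t x => driftDuhamel u (fun _ => (0 : E)) 0 t x with hD_def
  -- the two identities
  have hweak := hu.integral_eq_zero hψ hdiv
  have hW := integral_inner_driftDuhamel_zero_heatAdjoint_eq hE hum hM hT hψ hdiv
  simp_rw [hΛeq] at hW ⊢
  -- integrability of the slice pairings on `(0, T)`
  have hslm : ∀ τ, AEStronglyMeasurable (u τ) volume := fun τ =>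
    (hum.comp (measurable_const.prodMk measurable_id)).aestronglyMeasurable
  have hmeas' : AEStronglyMeasurable (uncurry u) ((volume.restrict (Ioc 0 T)).prod (volume : Measure E)) :=
    hum.aestronglyMeasurable
  have hmono : volume.restrict (Ioo (0:ℝ) T) ≤ volume.restrict (Ioc 0 T) :=
    Measure.restrict_mono Ioo_subset_Ioc_self le_rfl
  have hP : Integrable (fun t => ∫ x, ⟪u t x, Λ t x⟫) (volume.restrict (Ioo 0 T)) :=
    ((integrable_prod_inner_test_of_norm_le hmeas' (fun t _ => hslm t) (fun t _ x => hM t x)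
      hΛ).integral_prod_left).mono_measure hmono
  have hQ : Integrable (fun t => ∫ x, ⟪u t x, fderiv ℝ (ψ t) x (u t x)⟫) (volume.restrict (Ioo 0 T)) :=
    ((integrable_prod_inner_convect_test_of_norm_le hmeas' (fun t _ => hslm t) (fun t _ x => hM t x)
      hψ').integral_prod_left).mono_measure hmono
  have hDm : AEStronglyMeasurable (uncurry D) ((volume.restrict (Ioc 0 T)).prod (volume : Measure E)) :=
    aestronglyMeasurable_uncurry_driftDuhamel_zero hE hum hM le_rfl
  have hDsl : ∀ t ∈ Ioc (0:ℝ) T, AEStronglyMeasurable (D t) volume := fun t ht =>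
    (continuous_integral_sum_oseenHeat_duhamel hE (measurable_driftTensor hum measurable_const)
      (by have := (norm_nonneg _).trans (hM 0 0); positivity) ht.1.le
      (fun σ _ => abs_driftTensor_zero_le hM σ)).aestronglyMeasurable
  have hDM : ∀ t ∈ Ioc (0:ℝ) T, ∀ x, ‖D t x‖ ≤ 70632 * M ^ 2 * T ^ (1 / 2 : ℝ) := fun t ht x =>
    norm_driftDuhamel_zero_le hE hum hM (Ioc_subset_Icc_self ht) x
  have hR : Integrable (fun t => ∫ x, ⟪D t x, Λ t x⟫) (volume.restrict (Ioo 0 T)) :=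
    ((integrable_prod_inner_test_of_norm_le hDm hDsl hDM hΛ).integral_prod_left).mono_measure hmono
  -- slice by slice
  have hLint : ∀ t, Integrable (Λ t) volume := fun t =>
    (hΛ.contDiff_slice t).continuous.integrable_of_hasCompactSupport (hΛ.hasCompactSupport_slice t)
  have e1 : ∀ t ∈ Ioo (0:ℝ) T, ∫ x, ⟪u t x + D t x, Λ t x⟫ = (∫ x, ⟪u t x, Λ t x⟫) + ∫ x, ⟪D t x, Λ t x⟫ := by
    intro t ht
    have i1 : Integrable (fun x => ⟪u t x, Λ t x⟫) volume :=
      integrable_inner_of_aestronglyMeasurable_of_norm_le (hslm t) (fun x => hM t x) (hLint t)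
    have i2 : Integrable (fun x => ⟪D t x, Λ t x⟫) volume :=
      integrable_inner_of_aestronglyMeasurable_of_norm_le (hDsl t ⟨ht.1, ht.2.le⟩)
        (fun x => hDM t ⟨ht.1, ht.2.le⟩ x) (hLint t)
    rw [← integral_add i1 i2]
    exact integral_congr_ae (Eventually.of_forall fun x => inner_add_left _ _ _)
  have e2 : ∀ t ∈ Ioo (0:ℝ) T,
      (∫ x, (⟪u t x, timeDeriv ψ t x⟫ + ⟪u t x, convect (u t) (ψ t) x⟫ + 1 * ⟪u t x, Δ (ψ t) x⟫)) =
        (∫ x, ⟪u t x, Λ t x⟫) + ∫ x, ⟪u t x, fderiv ℝ (ψ t) x (u t x)⟫ := by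
    intro t ht
    have iP : Integrable (fun x => ⟪u t x, Λ t x⟫) volume :=
      integrable_inner_of_aestronglyMeasurable_of_norm_le (hslm t) (fun x => hM t x) (hLint t)
    have iQ : Integrable (fun x => ⟪u t x, fderiv ℝ (ψ t) x (u t x)⟫) volume :=
      (integrable_inner_clm_apply_of_norm_le (hslm t) (fun x => hM t x)
        ((hψ'.fderiv_top.contDiff_slice t).continuous.integrable_of_hasCompactSupport
          (hψ'.fderiv_top.hasCompactSupport_slice t))).1
    rw [← integral_add iP iQ]
    refine integral_congr_ae (Eventually.of_forall fun x => ?_)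
    simp only [hΛ_def, inner_add_right, real_inner_smul_right, convect_apply]
    ring
  rw [setIntegral_congr_fun measurableSet_Ioo e2, integral_add hP hQ] at hweak
  have hW' : ∫ t in Ioo 0 T, ∫ x, ⟪D t x, Λ t x⟫ = ∫ t in Ioo 0 T, ∫ x, ⟪u t x, fderiv ℝ (ψ t) x (u t x)⟫ := by
    rw [hD_def]
    simpa only [convect_apply] using hW
  rw [setIntegral_congr_fun measurableSet_Ioo e1, integral_add hP hR, hW', hweak]

/-- **The slices of `u + ∫₀ᵗ 𝒩_{t−σ}(u ⊗ u) dσ` are weakly divergence free for a.e. `t`** when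
`u` is a bounded weak solution (`div u = 0` in distributions; the Duhamel velocity is weakly
divergence free for every `t > 0`). [folklore] -/
theorem IsBoundedWeakNSSolutionOn.ae_isWeaklyDivFree_add_driftDuhamel {T : ℝ}
    (hu : IsBoundedWeakNSSolutionOn (Ioo 0 T) isOpen_Ioo 1 u) (hum : Measurable (uncurry u))
    (hM : ∀ t x, ‖u t x‖ ≤ M) :
    ∀ᵐ t ∂((volume : Measure ℝ).restrict (Ioo 0 T)),
      IsWeaklyDivFree (fun x => u t x + driftDuhamel u (fun _ => (0 : E)) 0 t x) := by
  have h1 := hu.ae_isWeaklyDivFree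
  have h2 : ∀ᵐ t ∂((volume : Measure ℝ).restrict (Ioo 0 T)), t ∈ Ioo 0 T := ae_restrict_mem measurableSet_Ioo
  filter_upwards [h1, h2] with t hdiv ht θ hθ
  have hg : Continuous (gradient θ) := continuous_gradient_of_contDiff (hθ.contDiff.of_le (by simp))
  have hgc : HasCompactSupport (gradient θ) :=
    hθ.hasCompactSupport.mono' fun x hx => by
      by_contra h
      exact hx (gradient_eq_zero_of_notMem_tsupport h)
  have hgi : Integrable (gradient θ) := hg.integrable_of_hasCompactSupport hgc
  have hslm : AEStronglyMeasurable (u t) volume :=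
    (hum.comp (measurable_const.prodMk measurable_id)).aestronglyMeasurable
  have hDc : Continuous (driftDuhamel u (fun _ => (0 : E)) 0 t) :=
    continuous_integral_sum_oseenHeat_duhamel hE (measurable_driftTensor hum measurable_const)
      (by have := (norm_nonneg _).trans (hM 0 0); positivity) ht.1.le
      (fun σ _ => abs_driftTensor_zero_le hM σ)
  have i1 : Integrable (fun x => ⟪u t x, gradient θ x⟫) volume :=
    integrable_inner_of_aestronglyMeasurable_of_norm_le hslm (fun x => hM t x) hgi
  have i2 : Integrable (fun x => ⟪driftDuhamel u (fun _ => (0 : E)) 0 t x, gradient θ x⟫) volume :=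
    integrable_inner_of_aestronglyMeasurable_of_norm_le hDc.aestronglyMeasurable
      (fun x => norm_driftDuhamel_zero_le hE hum hM (T := T) ⟨ht.1.le, ht.2.le⟩ x) hgi
  have hsplit : ∫ x, ⟪u t x + driftDuhamel u (fun _ => (0 : E)) 0 t x, gradient θ x⟫ =
      (∫ x, ⟪u t x, gradient θ x⟫) + ∫ x, ⟪driftDuhamel u (fun _ => (0 : E)) 0 t x, gradient θ x⟫ := by
    rw [← integral_add i1 i2]
    exact integral_congr_ae (Eventually.of_forall fun x => inner_add_left _ _ _)
  rw [hsplit, hdiv θ hθ, isWeaklyDivFree_driftDuhamel_zero hE hum hM ht.1 θ hθ, add_zero]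

end Weak

end Literature.Analysis.FluidPDE
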